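import Literature.AlgebraicGeometry.Motives.MixedHodgeStructureEndAlgJacobson
import Literature.AlgebraicGeometry.Motives.MixedHodgeStructureGrWConservative
import Literature.AlgebraicGeometry.Motives.MixedHodgeStructureSubadditiveFunctions
import HarnessLib

/-!
# The graded representation `End_MHS(H) → Π_k End(Gr^W_k H)`: faithfulness, dimension bounds, semisimplicity

The functor `Gr^W_•` from mixed `ℚ`-Hodge structures to graded pure Hodge structures is exact and FAITHFUL
(Cattani–El Zein–Griffiths–Lê, Prop. 3.2.4 (i) with Cor. 3.2.21 (i): morphisms are strict, so a morphism all of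
whose graded pieces vanish is zero — the tree's `Hom.eq_zero_of_forall_grMap_eq_zero`,
`Motives/MixedHodgeStructureGrWConservative`). On endomorphism algebras (`H.endAlg`,
`Motives/MixedHodgeStructureEndomorphismAlgebra`) this gives an INJECTIVE homomorphism of finite-dimensional
`ℚ`-algebras `End_MHS(H) ↪ Π_k End_MHS(Gr^W_k H)`, through which the Artin-algebra structure of `End_MHS(H)`
(Lam, *A First Course in Noncommutative Rings*, (19.17): the endomorphism ring of an indecomposable module of
finite length is local with nil radical; (19.1): `R` local iff `R ∖ U(R)` is an ideal iff `R/rad R` is a division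
ring; (4.12): the radical of an artinian ring is nilpotent) is controlled by the endomorphism algebras of the pure
graded pieces. This file proves:

* §1 **the graded representation**: `endAlg.grAlgHom H k : End_MHS(H) →ₐ[ℚ] End_MHS(Gr^W_k H)`,
  `a ↦ Gr^W_k(a)`; their product `endAlg.grPiAlgHom H` and its restriction `endAlg.grPiAlgHomOn H s` to a finite
  set `s` of indices; **injectivity** as soon as `s` contains every weight of `H` (`grPiAlgHom_injective`,
  `grPiAlgHomOn_injective`); for `k` not a weight `End_MHS(Gr^W_k H) = 0`.
* §2 **dimension bounds**: `dim_ℚ End_MHS(H) ≤ Σ_{k ∈ s} dim_ℚ End_MHS(Gr^W_k H)`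
  (`finrank_endAlg_le_sum_finrank_endAlg_gr`), and for `Hom`-spaces
  **`dim_ℚ Hom_MHS(H₁, H₂) ≤ Σ_k dim_ℚ Hom_MHS(Gr^W_k H₁, Gr^W_k H₂)`** (`finrank_hom_le_sum_gr_diag`, from the
  one-variable dévissages of `Motives/MixedHodgeStructureSubadditiveFunctions` and the vanishing of morphisms
  between pure structures of different weights).
* §3 **transfer of ring-theoretic properties along the faithful representation**: `End_MHS(H)` is commutative,
  resp. reduced, if all `End_MHS(Gr^W_k H)` (`k` a weight) are; if they are reduced then
  **`rad End_MHS(H) = 0` and `End_MHS(H)` is a semisimple `ℚ`-algebra** (its radical is nilpotent) — although `H`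
  itself need not be semisimple; e.g. when every `Gr^W_k H` is a simple Hodge structure (Schur).
* §4 **indecomposable `H`**: if the `End_MHS(Gr^W_k H)` are reduced, **every non-zero endomorphism of an
  indecomposable `H` is an automorphism** (`End_MHS(H)` is local with nil radical, and reduced, hence a division
  ring: `IsIndecomposable.isUnit_of_ne_zero_of_gr`); if moreover every `End_MHS(Gr^W_k H)` is `ℚ` (e.g. all graded
  pieces of rank one — iterated extensions of rank-one pure structures such as Kummer-type extensions of `ℚ(0)` by
  `ℚ(1)`), then **`End_MHS(H) = ℚ`** (`IsIndecomposable.endAlg_eq_bot_of_gr`,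
  `IsIndecomposable.finrank_endAlg_eq_one_of_finrank_grW_le_one`).

All statements proved; three definitions (the algebra homomorphisms), no named facts, no instances.

## References

* [CattaniElZeinGriffithsLe2014] E. Cattani, F. El Zein, P. A. Griffiths, Lê D. T. (eds.), Hodge Theory (2014),
  Prop. 3.2.4 (i) (p. 153), Thm. 3.2.18, Cor. 3.2.21 (i)–(ii) (p. 161), Ex. 3.2.23 (1).
* [DeligneHodgeII1971] P. Deligne, Théorie de Hodge II, Publ. Math. IHÉS 40 (1971), 1.1.11, Thm. 2.3.5 (iii).
* [Lam2001FirstCourse] T. Y. Lam, A First Course in Noncommutative Rings, 2nd ed. (2001), Thm. (19.1) (p. 280 of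
  the held text), Thm. (19.17) (p. 285), Thm. (4.12), §1 (reduced rings).
* [AuslanderReitenSmalo1995] M. Auslander, I. Reiten, S. Smalø, Representation Theory of Artin Algebras (1995),
  I §3–§4 (radical of an artin algebra; local endomorphism rings).
-/

noncomputable section

namespace Literature.AlgebraicGeometry.Motives

namespace MixedHodgeStructure

open Module

universe u v

variable {V : Type u} [AddCommGroup V] [Module ℚ V]

/-! ### §1 The graded representation -/

section GrAlgHom

variable (H : MixedHodgeStructure V)

/-- The endomorphism of MHS underlying `a ∈ End(H)`, on the `k`-th graded piece, as an element of
`End_MHS(Gr^W_k H)`. [cite: CattaniElZeinGriffithsLe2014, Cor. 3.2.21 (ii)] -/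
private theorem grMap_toHom_mem (a : H.endAlg) (k : ℤ) :
    (endAlg.toHom a).grMap k ∈ (H.gr k).toMixedHodgeStructure.endAlg :=
  ((endAlg.toHom a).gr k).toMixed.toLinearMap_mem_endAlg

/-- **`Gr^W_k : End_MHS(H) → End_MHS(Gr^W_k H)` is a homomorphism of `ℚ`-algebras** (`Gr^W_k` is an additive
functor: `Gr^W_k(id) = id`, `Gr^W_k(ab) = Gr^W_k(a) Gr^W_k(b)`, `Gr^W_k(a + b) = Gr^W_k(a) + Gr^W_k(b)`).
[cite: CattaniElZeinGriffithsLe2014, Cor. 3.2.21 (ii)] [cite: DeligneHodgeII1971, Thm. 2.3.5 (iii)] -/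
def endAlg.grAlgHom (k : ℤ) : H.endAlg →ₐ[ℚ] (H.gr k).toMixedHodgeStructure.endAlg where
  toFun a := ⟨(endAlg.toHom a).grMap k, grMap_toHom_mem H a k⟩
  map_one' := Subtype.ext (by
    change (endAlg.toHom (Hom.id H).toEndAlg).grMap k = LinearMap.id
    rw [Hom.toHom_toEndAlg, Hom.grMap_id])
  map_mul' a b := Subtype.ext (by
    change (endAlg.toHom ((endAlg.toHom a).comp (endAlg.toHom b)).toEndAlg).grMap k =
      (endAlg.toHom a).grMap k * (endAlg.toHom b).grMap k
    rw [Hom.toHom_toEndAlg, Hom.grMap_comp, Module.End.mul_eq_comp])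
  map_zero' := Subtype.ext (by
    change (endAlg.toHom (0 : H.endAlg)).grMap k = 0
    rw [show endAlg.toHom (0 : H.endAlg) = Hom.zero H H from Hom.ext rfl, Hom.grMap_zero])
  map_add' a b := Subtype.ext (by
    change (endAlg.toHom ((endAlg.toHom a).add (endAlg.toHom b)).toEndAlg).grMap k =
      (endAlg.toHom a).grMap k + (endAlg.toHom b).grMap k
    rw [Hom.toHom_toEndAlg, Hom.grMap_add])
  commutes' c := Subtype.ext (by
    change (endAlg.toHom (algebraMap ℚ H.endAlg c)).grMap k =
      ((algebraMap ℚ (H.gr k).toMixedHodgeStructure.endAlg c : _) : Module.End ℚ (grW H.W k))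
    refine LinearMap.ext fun q => ?_
    obtain ⟨x, rfl⟩ := Submodule.mkQ_surjective _ q
    rw [Submodule.mkQ_apply, Hom.grMap_mk, Subalgebra.coe_algebraMap, Module.algebraMap_end_apply,
      ← Submodule.Quotient.mk_smul]
    rfl)

/-- The underlying linear map of `Gr^W_k(a)` is `Gr^W_k` of the endomorphism `a` (by `rfl`).
[cite: CattaniElZeinGriffithsLe2014, Cor. 3.2.21 (ii)] -/
@[simp]
theorem endAlg.coe_grAlgHom_apply (k : ℤ) (a : H.endAlg) :
    ((endAlg.grAlgHom H k a : (H.gr k).toMixedHodgeStructure.endAlg) : Module.End ℚ (grW H.W k)) =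
      (endAlg.toHom a).grMap k :=
  rfl

/-- **The graded representation `End_MHS(H) → Π_k End_MHS(Gr^W_k H)`, `a ↦ (Gr^W_k a)_k`.**
[cite: CattaniElZeinGriffithsLe2014, Cor. 3.2.21 (ii)] [cite: DeligneHodgeII1971, Thm. 2.3.5 (iii)] -/
def endAlg.grPiAlgHom : H.endAlg →ₐ[ℚ] ∀ k : ℤ, (H.gr k).toMixedHodgeStructure.endAlg :=
  AlgHom.pi fun k => endAlg.grAlgHom H k

/-- Components of the graded representation (by `rfl`). [cite: CattaniElZeinGriffithsLe2014, Cor. 3.2.21 (ii)] -/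
@[simp]
theorem endAlg.grPiAlgHom_apply (a : H.endAlg) (k : ℤ) : endAlg.grPiAlgHom H a k = endAlg.grAlgHom H k a := rfl

/-- The graded representation on a finite set `s` of indices: `End_MHS(H) → Π_{k ∈ s} End_MHS(Gr^W_k H)`.
[cite: CattaniElZeinGriffithsLe2014, Cor. 3.2.21 (ii)] -/
def endAlg.grPiAlgHomOn (s : Finset ℤ) : H.endAlg →ₐ[ℚ] ∀ k : s, (H.gr k).toMixedHodgeStructure.endAlg :=
  AlgHom.pi fun k : s => endAlg.grAlgHom H k

/-- Components of `grPiAlgHomOn` (by `rfl`). [cite: CattaniElZeinGriffithsLe2014, Cor. 3.2.21 (ii)] -/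
@[simp]
theorem endAlg.grPiAlgHomOn_apply (s : Finset ℤ) (a : H.endAlg) (k : s) :
    endAlg.grPiAlgHomOn H s a k = endAlg.grAlgHom H k a := rfl

/-- `a = 0` in `End(H)` iff the endomorphism of MHS `a` is the zero morphism. [cite: CattaniElZeinGriffithsLe2014, Thm. 3.2.18] -/
theorem endAlg.eq_zero_iff_toHom_eq_zero (a : H.endAlg) : a = 0 ↔ endAlg.toHom a = Hom.zero H H :=
  ⟨fun h => Hom.ext (by rw [endAlg.toHom_toLinearMap, h]; rfl),
    fun h => Subtype.ext (by rw [← endAlg.toHom_toLinearMap a, h]; rfl)⟩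

/-- `Gr^W_k a = 0` in `End_MHS(Gr^W_k H)` iff the linear map `Gr^W_k(a)` vanishes. [cite: CattaniElZeinGriffithsLe2014, Cor. 3.2.21 (ii)] -/
theorem endAlg.grAlgHom_eq_zero_iff (k : ℤ) (a : H.endAlg) :
    endAlg.grAlgHom H k a = 0 ↔ (endAlg.toHom a).grMap k = 0 :=
  ⟨fun h => by rw [← endAlg.coe_grAlgHom_apply, h]; rfl, fun h => Subtype.ext (by rw [endAlg.coe_grAlgHom_apply, h]; rfl)⟩

/-- For `k` not a weight of `H`, `Gr^W_k H = 0` and so `End_MHS(Gr^W_k H) = 0`.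
[cite: CattaniElZeinGriffithsLe2014, Def. 3.2.15] -/
theorem subsingleton_endAlg_gr_of_not_isWeight {k : ℤ} (hk : ¬H.IsWeight k) :
    Subsingleton (H.gr k).toMixedHodgeStructure.endAlg := by
  haveI : Subsingleton (grW H.W k) := (subsingleton_grW_iff_not_isWeight H k).2 hk
  exact ⟨fun a b => Subtype.ext (LinearMap.ext fun x => Subsingleton.elim _ _)⟩

/-- Hence `Gr^W_k a = 0` for `k` not a weight. [cite: CattaniElZeinGriffithsLe2014, Def. 3.2.15] -/
theorem endAlg.grAlgHom_eq_zero_of_not_isWeight {k : ℤ} (hk : ¬H.IsWeight k) (a : H.endAlg) :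
    endAlg.grAlgHom H k a = 0 :=
  haveI := subsingleton_endAlg_gr_of_not_isWeight H hk
  Subsingleton.elim _ _

/-- **The graded representation is faithful: `a ↦ (Gr^W_k a)_k` is injective** (`Gr^W` is a faithful functor on
mixed Hodge structures, by strictness of morphisms). [cite: CattaniElZeinGriffithsLe2014, Prop. 3.2.4 (i) and Cor. 3.2.21 (i)]
[cite: DeligneHodgeII1971, 1.1.11 and Thm. 2.3.5 (iii)] -/
theorem endAlg.grPiAlgHom_injective : Function.Injective (endAlg.grPiAlgHom H) := by
  refine (injective_iff_map_eq_zero _).2 fun a ha => ?_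
  rw [endAlg.eq_zero_iff_toHom_eq_zero]
  exact (endAlg.toHom a).eq_zero_of_forall_grMap_eq_zero fun k =>
    (endAlg.grAlgHom_eq_zero_iff H k a).1 (by rw [← endAlg.grPiAlgHom_apply, ha]; rfl)

/-- **Faithfulness on a finite window: if `s` contains every weight of `H`, then
`End_MHS(H) → Π_{k ∈ s} End_MHS(Gr^W_k H)` is injective.** [cite: CattaniElZeinGriffithsLe2014, Prop. 3.2.4 (i) and Cor. 3.2.21 (i)]
[cite: DeligneHodgeII1971, Thm. 2.3.5 (iii)] -/
theorem endAlg.grPiAlgHomOn_injective (s : Finset ℤ) (hs : ∀ k, H.IsWeight k → k ∈ s) :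
    Function.Injective (endAlg.grPiAlgHomOn H s) := by
  refine (injective_iff_map_eq_zero _).2 fun a ha => ?_
  rw [endAlg.eq_zero_iff_toHom_eq_zero]
  refine (endAlg.toHom a).eq_zero_of_forall_grMap_eq_zero fun k => (endAlg.grAlgHom_eq_zero_iff H k a).1 ?_
  by_cases hk : H.IsWeight k
  · have h := congrFun ha ⟨k, hs k hk⟩
    rw [endAlg.grPiAlgHomOn_apply] at h
    exact h
  · exact endAlg.grAlgHom_eq_zero_of_not_isWeight H hk a

/-- All weights of `H` lie in the window `(a, b]` when `W_a = 0` and `W_b = V`. [cite: CattaniElZeinGriffithsLe2014, Def. 3.2.15] -/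
theorem isWeight_mem_Ioc {a b : ℤ} (ha : H.W a = ⊥) (hb : H.W b = ⊤) (k : ℤ) (hk : H.IsWeight k) :
    k ∈ Finset.Ioc a b := by
  rw [Finset.mem_Ioc]
  by_contra h
  rw [not_and_or, not_lt, not_le] at h
  rcases h with h | h
  · have h1 : H.W k ≤ ⊥ := ha ▸ H.monotone_W h
    exact hk.ne (le_antisymm (H.monotone_W (by omega)) ((le_bot_iff.1 h1).symm ▸ bot_le))
  · have h1 : ⊤ ≤ H.W (k - 1) := hb ▸ H.monotone_W (by omega)
    exact hk.ne (le_antisymm (H.monotone_W (by omega)) ((top_le_iff.1 h1).symm ▸ le_top))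

end GrAlgHom

/-! ### §2 Dimension bounds -/

section Finrank

variable [FiniteDimensional ℚ V] (H : MixedHodgeStructure V)

/-- **`dim_ℚ End_MHS(H) ≤ Σ_{k ∈ s} dim_ℚ End_MHS(Gr^W_k H)`** for any finite `s` containing the weights of `H`
(the graded representation is injective). [cite: CattaniElZeinGriffithsLe2014, Prop. 3.2.4 (i) and Cor. 3.2.21]
[cite: DeligneHodgeII1971, Thm. 2.3.5 (iii)] -/
theorem finrank_endAlg_le_sum_finrank_endAlg_gr (s : Finset ℤ) (hs : ∀ k, H.IsWeight k → k ∈ s) :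
    finrank ℚ H.endAlg ≤ ∑ k ∈ s, finrank ℚ (H.gr k).toMixedHodgeStructure.endAlg := by
  haveI : ∀ k : s, FiniteDimensional ℚ (H.gr (k : ℤ)).toMixedHodgeStructure.endAlg := fun k =>
    finiteDimensional_endAlg _
  calc finrank ℚ H.endAlg ≤ finrank ℚ (∀ k : s, (H.gr k).toMixedHodgeStructure.endAlg) :=
        LinearMap.finrank_le_finrank_of_injective (f := (endAlg.grPiAlgHomOn H s).toLinearMap)
          (endAlg.grPiAlgHomOn_injective H s hs)
    _ = ∑ k : s, finrank ℚ (H.gr (k : ℤ)).toMixedHodgeStructure.endAlg := Module.finrank_pi_fintype ℚ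
    _ = ∑ k ∈ s, finrank ℚ (H.gr k).toMixedHodgeStructure.endAlg :=
        Finset.sum_coe_sort s fun k => finrank ℚ (H.gr k).toMixedHodgeStructure.endAlg

/-- Window form: `dim_ℚ End_MHS(H) ≤ Σ_{a < k ≤ b} dim_ℚ End_MHS(Gr^W_k H)` when `W_a = 0`, `W_b = V`.
[cite: CattaniElZeinGriffithsLe2014, Prop. 3.2.4 (i) and Cor. 3.2.21] -/
theorem finrank_endAlg_le_sum_Ioc_finrank_endAlg_gr {a b : ℤ} (ha : H.W a = ⊥) (hb : H.W b = ⊤) :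
    finrank ℚ H.endAlg ≤ ∑ k ∈ Finset.Ioc a b, finrank ℚ (H.gr k).toMixedHodgeStructure.endAlg :=
  finrank_endAlg_le_sum_finrank_endAlg_gr H _ (isWeight_mem_Ioc H ha hb)

variable {V' : Type v} [AddCommGroup V'] [Module ℚ V'] [FiniteDimensional ℚ V']

/-- **`dim_ℚ Hom_MHS(H₁, H₂) ≤ Σ_{a < k ≤ b} dim_ℚ Hom_MHS(Gr^W_k H₁, Gr^W_k H₂)`** for a common window
`W_a = 0`, `W_b = V` of `H₁` and `H₂`: dévissage of both variables along the weight filtrations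
(`Motives/MixedHodgeStructureSubadditiveFunctions`), the mixed terms `Hom(Gr_k H₁, Gr_l H₂)`, `k ≠ l`, vanishing
(pure of different weights). [cite: CattaniElZeinGriffithsLe2014, Thm. 3.2.18 (iii) and Cor. 3.2.21] [cite: Krause2021, §13.1 (SF2)] -/
theorem finrank_hom_le_sum_gr_diag (H₁ : MixedHodgeStructure V) (H₂ : MixedHodgeStructure V') {a b : ℤ}
    (ha₁ : H₁.W a = ⊥) (hb₁ : H₁.W b = ⊤) (ha₂ : H₂.W a = ⊥) (hb₂ : H₂.W b = ⊤) :
    finrank ℚ ((hom H₁ H₂).hodgeClasses 0) ≤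
      ∑ k ∈ Finset.Ioc a b, finrank ℚ ((hom (H₁.gr k).toMixedHodgeStructure (H₂.gr k).toMixedHodgeStructure).hodgeClasses 0) := by
  refine (finrank_hom_le_sum_gr_right H₁ ha₂ hb₂).trans ?_
  refine Finset.sum_le_sum fun l hl => ?_
  refine (finrank_hom_le_sum_gr_left (H₂.gr l).toMixedHodgeStructure ha₁ hb₁).trans (le_of_eq ?_)
  rw [Finset.sum_eq_single l (fun k _ hkl => forall_hom_eq_zero_iff_finrank_eq_zero.1 fun f =>
    (HodgeStructure.isPure_toMixedHodgeStructure (H₁.gr k)).hom_eq_zero_of_ne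
      (HodgeStructure.isPure_toMixedHodgeStructure (H₂.gr l)) hkl f) (fun h => absurd hl h)]

end Finrank

/-! ### §3 Transfer of ring-theoretic properties along the graded representation -/

section Transfer

variable [FiniteDimensional ℚ V] (H : MixedHodgeStructure V)

omit [FiniteDimensional ℚ V] in
/-- **If every `End_MHS(Gr^W_k H)` (`k` a weight) is commutative, so is `End_MHS(H)`.**
[cite: CattaniElZeinGriffithsLe2014, Prop. 3.2.4 (i) and Cor. 3.2.21] -/
theorem endAlg_mul_comm_of_gr
    (h : ∀ k, H.IsWeight k → ∀ x y : (H.gr k).toMixedHodgeStructure.endAlg, x * y = y * x) (a b : H.endAlg) :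
    a * b = b * a := by
  refine endAlg.grPiAlgHom_injective H (funext fun k => ?_)
  rw [map_mul, map_mul, Pi.mul_apply, Pi.mul_apply, endAlg.grPiAlgHom_apply, endAlg.grPiAlgHom_apply]
  by_cases hk : H.IsWeight k
  · exact h k hk _ _
  · haveI := subsingleton_endAlg_gr_of_not_isWeight H hk
    exact Subsingleton.elim _ _

omit [FiniteDimensional ℚ V] in
/-- **If every `End_MHS(Gr^W_k H)` (`k` a weight) is reduced, so is `End_MHS(H)`** (a nilpotent endomorphism
with all `Gr^W_k` nilpotent in reduced rings has all `Gr^W_k` zero, hence is zero). [cite: Lam2001FirstCourse, §1 (reduced rings)]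
[cite: CattaniElZeinGriffithsLe2014, Prop. 3.2.4 (i)] -/
theorem isReduced_endAlg_of_gr (h : ∀ k, H.IsWeight k → IsReduced (H.gr k).toMixedHodgeStructure.endAlg) :
    IsReduced H.endAlg := by
  refine ⟨fun a ha => endAlg.grPiAlgHom_injective H ?_⟩
  rw [map_zero]
  refine funext fun k => ?_
  rw [Pi.zero_apply, endAlg.grPiAlgHom_apply]
  by_cases hk : H.IsWeight k
  · haveI := h k hk
    exact (ha.map (endAlg.grAlgHom H k)).eq_zero
  · exact endAlg.grAlgHom_eq_zero_of_not_isWeight H hk a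

/-- **If the `End_MHS(Gr^W_k H)` are reduced then `rad End_MHS(H) = 0`** (the radical of the artinian ring
`End_MHS(H)` is nilpotent, and `End_MHS(H)` is reduced). [cite: Lam2001FirstCourse, Thm. (4.12)]
[cite: CattaniElZeinGriffithsLe2014, Prop. 3.2.4 (i)] -/
theorem jacobson_endAlg_eq_bot_of_gr (h : ∀ k, H.IsWeight k → IsReduced (H.gr k).toMixedHodgeStructure.endAlg) :
    Ring.jacobson H.endAlg = ⊥ := by
  haveI := isReduced_endAlg_of_gr H h
  refine (Submodule.eq_bot_iff _).2 fun a ha => ?_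
  exact (isNilpotent_of_mem_jacobson ha).eq_zero

/-- **If the `End_MHS(Gr^W_k H)` are reduced then `End_MHS(H)` is a semisimple `ℚ`-algebra** (artinian with zero
radical) — although `H` itself need not be semisimple. [cite: Lam2001FirstCourse, Thm. (4.14)]
[cite: CattaniElZeinGriffithsLe2014, Prop. 3.2.4 (i)] -/
theorem isSemisimpleRing_endAlg_of_gr (h : ∀ k, H.IsWeight k → IsReduced (H.gr k).toMixedHodgeStructure.endAlg) :
    IsSemisimpleRing H.endAlg := by
  haveI := isArtinianRing_endAlg H
  exact IsArtinianRing.isSemisimpleRing_iff_jacobson.2 (jacobson_endAlg_eq_bot_of_gr H h)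

omit [FiniteDimensional ℚ V] in
/-- A ring in which every non-zero element is a unit is reduced. [cite: Lam2001FirstCourse, §1 (reduced rings)] -/
private theorem isReduced_of_forall_isUnit {R : Type*} [Ring R] (h : ∀ a : R, a ≠ 0 → IsUnit a) : IsReduced R := by
  refine ⟨fun a ha => ?_⟩
  by_contra hne
  obtain ⟨n, hn⟩ := ha
  have hu : IsUnit (a ^ n) := (h a hne).pow n
  rw [hn, isUnit_zero_iff] at hu
  haveI : Subsingleton R := subsingleton_of_zero_eq_one hu
  exact hne (Subsingleton.elim _ _)

/-- **`End_MHS(S)` of a simple `S` is reduced** (a division ring, Schur). [cite: Lam2001FirstCourse, (3.6) Schur's Lemma]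
[cite: CattaniElZeinGriffithsLe2014, p. 270] -/
theorem IsSimple.isReduced_endAlg {H : MixedHodgeStructure V} (hH : H.IsSimple) : IsReduced H.endAlg :=
  isReduced_of_forall_isUnit hH.isUnit_of_ne_zero

/-- **If every graded piece `Gr^W_k H` (`k` a weight) is a SIMPLE Hodge structure, then `rad End_MHS(H) = 0` and
`End_MHS(H)` is semisimple** (`End_MHS(H) ↪ Π_k D_k`, `D_k = End(Gr^W_k H)` division rings).
[cite: Lam2001FirstCourse, (3.6) and Thm. (4.14)] [cite: CattaniElZeinGriffithsLe2014, Prop. 3.2.4 (i) and p. 270] -/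
theorem isSemisimpleRing_endAlg_of_gr_isSimple (h : ∀ k, H.IsWeight k → (H.gr k).toMixedHodgeStructure.IsSimple) :
    Ring.jacobson H.endAlg = ⊥ ∧ IsSemisimpleRing H.endAlg :=
  ⟨jacobson_endAlg_eq_bot_of_gr H fun k hk => (h k hk).isReduced_endAlg,
    isSemisimpleRing_endAlg_of_gr H fun k hk => (h k hk).isReduced_endAlg⟩

end Transfer

/-! ### §4 Indecomposable mixed Hodge structures with reduced graded endomorphism algebras -/

section Indecomposable

variable [FiniteDimensional ℚ V] {H : MixedHodgeStructure V}

/-- **Every non-zero endomorphism of an indecomposable `H` whose graded pieces have reduced endomorphism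
algebras is an automorphism**: `End_MHS(H)` is local with nil radical ((19.17)) and reduced (§3), so its
non-units — being nilpotent — vanish; `End_MHS(H)` is a division ring ((19.1)). [cite: Lam2001FirstCourse, Thm. (19.17) and Thm. (19.1)]
[cite: CattaniElZeinGriffithsLe2014, Prop. 3.2.4 (i)] -/
theorem IsIndecomposable.isUnit_of_ne_zero_of_gr (hH : H.IsIndecomposable)
    (h : ∀ k, H.IsWeight k → IsReduced (H.gr k).toMixedHodgeStructure.endAlg) {a : H.endAlg} (ha : a ≠ 0) :
    IsUnit a := by
  by_contra hu
  haveI := isReduced_endAlg_of_gr H h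
  exact ha (hH.isNilpotent_of_not_isUnit a hu).eq_zero

/-- Morphism form: a non-zero endomorphism of MHS of such an `H` is bijective. [cite: Lam2001FirstCourse, Thm. (19.17) and Thm. (19.1)]
[cite: CattaniElZeinGriffithsLe2014, Thm. 3.2.18] -/
theorem IsIndecomposable.bijective_of_ne_zero_of_gr (hH : H.IsIndecomposable)
    (h : ∀ k, H.IsWeight k → IsReduced (H.gr k).toMixedHodgeStructure.endAlg) (f : Hom H H)
    (hf : f ≠ Hom.zero H H) : Function.Bijective f.toLinearMap := by
  have hne : f.toEndAlg ≠ 0 := fun h0 => hf (by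
    rw [← Hom.toHom_toEndAlg f, h0]; exact (endAlg.eq_zero_iff_toHom_eq_zero H 0).1 rfl)
  exact (endAlg.isUnit_iff_bijective _).1 (hH.isUnit_of_ne_zero_of_gr h hne)

/-- **Indecomposable with simple graded pieces: every non-zero endomorphism is an automorphism.**
[cite: Lam2001FirstCourse, Thm. (19.17), Thm. (19.1) and (3.6)] [cite: CattaniElZeinGriffithsLe2014, p. 270] -/
theorem IsIndecomposable.isUnit_of_ne_zero_of_gr_isSimple (hH : H.IsIndecomposable)
    (h : ∀ k, H.IsWeight k → (H.gr k).toMixedHodgeStructure.IsSimple) {a : H.endAlg} (ha : a ≠ 0) : IsUnit a :=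
  hH.isUnit_of_ne_zero_of_gr (fun k hk => (h k hk).isReduced_endAlg) ha

omit [FiniteDimensional ℚ V] in
/-- An indecomposable MHS has a weight. [cite: CattaniElZeinGriffithsLe2014, Def. 3.2.15] -/
theorem IsIndecomposable.exists_isWeight (hH : H.IsIndecomposable) : ∃ k, H.IsWeight k := by
  by_contra h
  rw [not_exists] at h
  haveI : Subsingleton V := (subsingleton_iff_forall_subsingleton_grW H).2 fun k =>
    (subsingleton_grW_iff_not_isWeight H k).2 (h k)
  haveI := hH.nontrivial
  exact false_of_nontrivial_of_subsingleton V

omit [FiniteDimensional ℚ V] in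
/-- For a weight `k`, `End_MHS(Gr^W_k H)` is a non-trivial ring. [cite: CattaniElZeinGriffithsLe2014, Def. 3.2.15] -/
theorem nontrivial_endAlg_gr_of_isWeight {k : ℤ} (hk : H.IsWeight k) :
    Nontrivial (H.gr k).toMixedHodgeStructure.endAlg := by
  haveI : Nontrivial (grW H.W k) := by
    by_contra hnt
    exact (subsingleton_grW_iff_not_isWeight H k).1 (not_nontrivial_iff_subsingleton.1 hnt) hk
  exact ⟨⟨0, 1, fun h01 => zero_ne_one (congrArg (fun a : (H.gr k).toMixedHodgeStructure.endAlg =>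
    (a : Module.End ℚ (grW H.W k))) h01)⟩⟩

/-- A scalar algebra (`every element is a scalar`) is reduced. [cite: Lam2001FirstCourse, §1 (reduced rings)] -/
private theorem isReduced_of_forall_eq_algebraMap {R : Type*} [Ring R] [Algebra ℚ R]
    (h : ∀ b : R, ∃ c : ℚ, b = algebraMap ℚ R c) : IsReduced R := by
  refine isReduced_of_forall_isUnit fun a ha => ?_
  obtain ⟨c, rfl⟩ := h a
  have hc : c ≠ 0 := fun hc => ha (by rw [hc, map_zero])
  exact (IsUnit.mk0 c hc).map (algebraMap ℚ R)

/-- **`End_MHS(H) = ℚ` for an indecomposable `H` all of whose graded pieces have `End_MHS(Gr^W_k H) = ℚ`**: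
for `a ∈ End(H)` and a weight `k₀` with `Gr^W_{k₀} a = c · 1`, the endomorphism `a - c` has a vanishing graded
component, so is not a unit, so is nilpotent ((19.17)), so is zero (§3). [cite: Lam2001FirstCourse, Thm. (19.17) and Thm. (19.1)]
[cite: CattaniElZeinGriffithsLe2014, Prop. 3.2.4 (i)] -/
theorem IsIndecomposable.exists_eq_algebraMap_of_gr (hH : H.IsIndecomposable)
    (h : ∀ k, H.IsWeight k → ∀ b : (H.gr k).toMixedHodgeStructure.endAlg, ∃ c : ℚ, b = algebraMap ℚ _ c)
    (a : H.endAlg) : ∃ c : ℚ, a = algebraMap ℚ H.endAlg c := by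
  obtain ⟨k₀, hk₀⟩ := hH.exists_isWeight
  obtain ⟨c, hc⟩ := h k₀ hk₀ (endAlg.grAlgHom H k₀ a)
  refine ⟨c, ?_⟩
  have hred : IsReduced H.endAlg := isReduced_endAlg_of_gr H fun k hk =>
    isReduced_of_forall_eq_algebraMap (R := (H.gr k).toMixedHodgeStructure.endAlg) (h k hk)
  have h0 : endAlg.grAlgHom H k₀ (a - algebraMap ℚ H.endAlg c) = 0 := by
    rw [map_sub, AlgHom.commutes, hc, sub_self]
  have hnu : ¬IsUnit (a - algebraMap ℚ H.endAlg c) := fun hu => by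
    haveI := nontrivial_endAlg_gr_of_isWeight hk₀
    have hu' := hu.map (endAlg.grAlgHom H k₀)
    rw [h0, isUnit_zero_iff] at hu'
    exact zero_ne_one hu'
  exact sub_eq_zero.1 ((hH.isNilpotent_of_not_isUnit _ hnu).eq_zero)

/-- **Hence `End_MHS(H)` is the subalgebra of scalars**: `H.endAlg = ⊥` in `End_ℚ(V)`. [cite: Lam2001FirstCourse, Thm. (19.17) and Thm. (19.1)]
[cite: CattaniElZeinGriffithsLe2014, Prop. 3.2.4 (i)] -/
theorem IsIndecomposable.endAlg_eq_bot_of_gr (hH : H.IsIndecomposable)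
    (h : ∀ k, H.IsWeight k → ∀ b : (H.gr k).toMixedHodgeStructure.endAlg, ∃ c : ℚ, b = algebraMap ℚ _ c) :
    H.endAlg = ⊥ := by
  refine le_antisymm (fun x hx => ?_) bot_le
  obtain ⟨c, hc⟩ := hH.exists_eq_algebraMap_of_gr h ⟨x, hx⟩
  have hx' : x = algebraMap ℚ (Module.End ℚ V) c := by
    rw [← Subalgebra.coe_algebraMap H.endAlg c, ← hc]
  rw [hx']
  exact Subalgebra.algebraMap_mem _ c

/-- **and `dim_ℚ End_MHS(H) = 1`.** [cite: Lam2001FirstCourse, Thm. (19.17) and Thm. (19.1)] [cite: CattaniElZeinGriffithsLe2014, Prop. 3.2.4 (i)] -/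
theorem IsIndecomposable.finrank_endAlg_eq_one_of_gr (hH : H.IsIndecomposable)
    (h : ∀ k, H.IsWeight k → ∀ b : (H.gr k).toMixedHodgeStructure.endAlg, ∃ c : ℚ, b = algebraMap ℚ _ c) :
    finrank ℚ H.endAlg = 1 := by
  haveI := hH.nontrivial
  rw [hH.endAlg_eq_bot_of_gr h]
  exact Subalgebra.finrank_bot

/-- In a non-trivial finite-dimensional `ℚ`-algebra of dimension `≤ 1` every element is a scalar.
[cite: Lam2001FirstCourse, §1] -/
private theorem forall_eq_algebraMap_of_finrank_le_one {R : Type*} [Ring R] [Algebra ℚ R] [Nontrivial R]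
    [FiniteDimensional ℚ R] (h : finrank ℚ R ≤ 1) (b : R) : ∃ c : ℚ, b = algebraMap ℚ R c := by
  obtain ⟨v, hv⟩ := finrank_le_one_iff.1 h
  obtain ⟨c₁, hc₁⟩ := hv 1
  obtain ⟨c, hcb⟩ := hv b
  have hc₁0 : c₁ ≠ 0 := fun h0 => one_ne_zero ((hc₁.symm.trans (by rw [h0, zero_smul])) : (1 : R) = 0)
  refine ⟨c / c₁, ?_⟩
  rw [Algebra.algebraMap_eq_smul_one, ← hc₁, smul_smul, div_mul_cancel₀ c hc₁0, hcb]

/-- **Indecomposable `H` with `dim_ℚ End_MHS(Gr^W_k H) ≤ 1` for every weight `k` has `End_MHS(H) = ℚ`.**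
[cite: Lam2001FirstCourse, Thm. (19.17) and Thm. (19.1)] [cite: CattaniElZeinGriffithsLe2014, Prop. 3.2.4 (i)] -/
theorem IsIndecomposable.finrank_endAlg_eq_one_of_finrank_endAlg_gr_le_one (hH : H.IsIndecomposable)
    (h : ∀ k, H.IsWeight k → finrank ℚ (H.gr k).toMixedHodgeStructure.endAlg ≤ 1) : finrank ℚ H.endAlg = 1 :=
  hH.finrank_endAlg_eq_one_of_gr fun k hk b => by
    haveI := nontrivial_endAlg_gr_of_isWeight hk
    haveI := finiteDimensional_endAlg (H.gr k).toMixedHodgeStructure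
    exact forall_eq_algebraMap_of_finrank_le_one (h k hk) b

/-- `dim_ℚ End_MHS(G) ≤ (dim_ℚ U)²` (a subalgebra of `End_ℚ(U)`). [cite: CattaniElZeinGriffithsLe2014, Thm. 3.2.18] -/
theorem finrank_endAlg_le_finrank_sq {U : Type v} [AddCommGroup U] [Module ℚ U] [FiniteDimensional ℚ U]
    (G : MixedHodgeStructure U) : finrank ℚ G.endAlg ≤ finrank ℚ U * finrank ℚ U := by
  rw [← Module.finrank_linearMap ℚ ℚ U U]
  exact Submodule.finrank_le (Subalgebra.toSubmodule G.endAlg)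

/-- **Indecomposable `H` all of whose graded pieces `Gr^W_k H` have rank `≤ 1` (e.g. iterated non-split extensions
of rank-one pure structures, such as Kummer-type extensions of `ℚ(0)` by `ℚ(1)`) has `End_MHS(H) = ℚ`.**
[cite: Lam2001FirstCourse, Thm. (19.17) and Thm. (19.1)] [cite: CattaniElZeinGriffithsLe2014, Prop. 3.2.4 (i) and Ex. 3.2.23] -/
theorem IsIndecomposable.finrank_endAlg_eq_one_of_finrank_grW_le_one (hH : H.IsIndecomposable)
    (h : ∀ k, H.IsWeight k → finrank ℚ (grW H.W k) ≤ 1) : finrank ℚ H.endAlg = 1 :=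
  hH.finrank_endAlg_eq_one_of_finrank_endAlg_gr_le_one fun k hk =>
    (finrank_endAlg_le_finrank_sq (H.gr k).toMixedHodgeStructure).trans
      ((Nat.mul_le_mul (h k hk) (h k hk)).trans (le_of_eq (one_mul 1)))

/-- Morphism form of `End_MHS(H) = ℚ`: every endomorphism of MHS of such an `H` is a rational multiple of the
identity. [cite: Lam2001FirstCourse, Thm. (19.17) and Thm. (19.1)] [cite: CattaniElZeinGriffithsLe2014, Prop. 3.2.4 (i)] -/
theorem IsIndecomposable.exists_toLinearMap_eq_smul_id_of_gr (hH : H.IsIndecomposable)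
    (h : ∀ k, H.IsWeight k → ∀ b : (H.gr k).toMixedHodgeStructure.endAlg, ∃ c : ℚ, b = algebraMap ℚ _ c)
    (f : Hom H H) : ∃ c : ℚ, f.toLinearMap = c • LinearMap.id := by
  obtain ⟨c, hc⟩ := hH.exists_eq_algebraMap_of_gr h f.toEndAlg
  refine ⟨c, ?_⟩
  rw [← Hom.coe_toEndAlg, hc, Subalgebra.coe_algebraMap, Algebra.algebraMap_eq_smul_one]
  rfl

end Indecomposable

end MixedHodgeStructure

end Literature.AlgebraicGeometry.Motives
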